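import Summits.HubbardSuperconductivity.HubbardSuperconductivity.Theorems.BalabanIRBirComplexStableXYRStubBondGradientPrecision
import Summits.HubbardSuperconductivity.HubbardSuperconductivity.Theorems.BalabanIRBirComplexStableXYRStubGaussianRealTail
import Summits.HubbardSuperconductivity.HubbardSuperconductivity.Theorems.BalabanIRBirComplexStableXYRStubMultivariateGaussianFunctional
import HarnessLib

/-!
# Crux `BirComplexStableXYR`, line `fat-gaussian-defect-calculus`: stub C3 `stub_bondGradientTail`

Registered stub (lead c8, wave 13, skeleton `Cruxes/BirComplexStableXYR/Lines/fat_gaussian_defect_calculus.lean`),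
helper (`--supports`) for the crux `Summit.HubbardSuperconductivity.HubbardSuperconductivity.Theses.BalabanIR.BirComplexStableXYR`:
**bond-gradient tails under the pinned thin Gaussian.**

**Statement.** With the window-Hessian matrix `H` of the thin form (entries supplied by hypothesis `hH`) and its
pinned block `H' = H|_{Λ∖0}`: for `K > 0`, every bond `(x,i)` of the space–time torus `Λ L M` (chart
`TorusChart.piProdZMod 2 L M`) and every `t ≥ 0`, the pinned thin Gaussian `N(0,(K•H')⁻¹)` of `ψ : Λ∖0 → ℝ`
(Mathlib `multivariateGaussian`, on `EuclideanSpace`) gives the bond gradient of the extension by zero `ψ̂ = extZero ψ`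
the sub-Gaussian tail `P(|d₀ψ̂(x,i)| ≥ t) ≤ 2·exp(−c₀Kt²)`: large fields are rare under the reference Gaussian.

**Proof.** Assembly of three landed stubs.  (C2b, `stub_multivariateGaussian_functional`) the law of the linear
functional `ψ ↦ a·ψ` under `N(0,S)` (`S = (K•H')⁻¹`, positive semidefinite as the inverse of the positive definite
`K•H'`, the latter exactly as in C1: symmetry of `H`, coercivity `stub_thinFormCoercive` + `thinForm_d0_eq_hessianForm`,
`TorusChart.posDef_submatrix_of_d₀_coercive`) is `gaussianReal 0 (aᵀSa).toNNReal`; with the bond functional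
`a_j = [j = x+e_i] − [j = x]` one has `a·ψ = d₀ψ̂(x,i)` (`bondGradPrec_dotProduct_eq`), so the event is the preimage of
`{t ≤ |y|}` and `Measure.map_apply` transports its measure.  (C1, `stub_bondGradientPrecision`) `aᵀSa ≤ 1/(2c₀K)`.
(C2a, `stub_gaussianRealTail`) `P(|Y| ≥ t) ≤ 2e^{−t²/(2v)}` for `Y ∼ N(0,v)`; for `0 < v = aᵀSa ≤ 1/(2c₀K)` the exponent
satisfies `c₀Kt² ≤ t²/(2v)`.  Degenerate cases: `t = 0` (a probability is `≤ 1 ≤ 2`) and `aᵀSa ≤ 0` with `t > 0`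
(the law is the Dirac mass `gaussianReal_zero_var`, and `0 ∉ {t ≤ |y|}`).  No definition, no named fact; sorry-free.
[folklore]
-/

set_option linter.dupNamespace false -- `Summit.<S>.<S>.Theorems…` repeats the summit name (D-0017 layout)

noncomputable section

namespace Summit.HubbardSuperconductivity.HubbardSuperconductivity.Theorems.FSUnfolding

open scoped BigOperators Matrix ENNReal NNReal
open MeasureTheory ProbabilityTheory WithLp
open Literature.MathematicalPhysics.QuantumFieldTheory Literature.Probability.LatticeModels
open Summit.HubbardSuperconductivity.BirComplexStableXYNegative

/-- **One-dimensional tail with a variance budget.**  If `σ² ≤ 1/(2c₀K)` (`c₀, K > 0`) then for `t ≥ 0` the centred real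
Gaussian of variance `σ².toNNReal` satisfies `P(|Y| ≥ t) ≤ 2e^{−c₀Kt²}` (C2a for `σ² > 0, t > 0`; the Dirac law for
`σ² ≤ 0 < t`; trivial for `t = 0`). [folklore] -/
theorem hsc_bondTail_gaussianReal_le {c₀ K σ2 : ℝ} (hc₀ : 0 < c₀) (hK : 0 < K)
    (hσ : σ2 ≤ 1 / (2 * c₀ * K)) {t : ℝ} (ht : 0 ≤ t) :
    gaussianReal 0 σ2.toNNReal {y : ℝ | t ≤ |y|} ≤ ENNReal.ofReal (2 * Real.exp (-(c₀ * K * t ^ 2))) := by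
  rcases ht.eq_or_lt with rfl | ht0
  · -- `t = 0`: a probability is at most `1 ≤ 2 = 2e⁰`
    refine prob_le_one.trans ?_
    rw [ENNReal.one_le_ofReal]
    norm_num
  rcases le_or_gt σ2 0 with hσ0 | hσ0
  · -- degenerate variance: the law is `δ₀` and `0 ∉ {t ≤ |y|}`
    rw [Real.toNNReal_eq_zero.mpr hσ0, gaussianReal_zero_var, Measure.dirac_apply, Set.indicator_of_notMem]
    · exact zero_le
    · simp only [Set.mem_setOf_eq, abs_zero, not_le]
      exact ht0
  · -- positive variance: C2a and the exponent comparison `c₀Kt² ≤ t²/(2σ²)`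
    refine (stub_gaussianRealTail _ t ht).trans (ENNReal.ofReal_le_ofReal ?_)
    refine mul_le_mul_of_nonneg_left (Real.exp_le_exp.mpr (neg_le_neg ?_)) zero_le_two
    rw [Real.coe_toNNReal _ hσ0.le, le_div_iff₀ (by positivity)]
    have h1 : σ2 * (2 * c₀ * K) ≤ 1 := by rwa [← le_div_iff₀ (by positivity)]
    nlinarith [sq_nonneg t, mul_pos hc₀ hK]

/-- **Tail of a linear functional under a centred lattice Gaussian with a variance budget.**  For `S` positive
semidefinite and `aᵀSa ≤ 1/(2c₀K)`: `P_{N(0,S)}(|a·ψ| ≥ t) ≤ 2e^{−c₀Kt²}` for `t ≥ 0` (C2b transports the event to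
the real line, then `hsc_bondTail_gaussianReal_le`). [folklore] -/
theorem hsc_bondTail_functional_le {ι : Type} [Fintype ι] [DecidableEq ι] {S : Matrix ι ι ℝ}
    (hS : S.PosSemidef) (a : ι → ℝ) {c₀ K : ℝ} (hc₀ : 0 < c₀) (hK : 0 < K)
    (hvar : a ⬝ᵥ S *ᵥ a ≤ 1 / (2 * c₀ * K)) {t : ℝ} (ht : 0 ≤ t) :
    multivariateGaussian 0 S {ψ : EuclideanSpace ℝ ι | t ≤ |a ⬝ᵥ ofLp ψ|} ≤
      ENNReal.ofReal (2 * Real.exp (-(c₀ * K * t ^ 2))) := by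
  have hmeas : Measurable (fun ψ : EuclideanSpace ℝ ι => a ⬝ᵥ ofLp ψ) := by
    rw [hsc_dotProduct_ofLp_eq_innerSL a]
    exact ContinuousLinearMap.measurable _
  have hms : MeasurableSet {y : ℝ | t ≤ |y|} := measurableSet_le measurable_const continuous_abs.measurable
  rw [show {ψ : EuclideanSpace ℝ ι | t ≤ |a ⬝ᵥ ofLp ψ|} = (fun ψ => a ⬝ᵥ ofLp ψ) ⁻¹' {y : ℝ | t ≤ |y|} from rfl,
    ← Measure.map_apply hmeas hms, stub_multivariateGaussian_functional ι S hS a]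
  exact hsc_bondTail_gaussianReal_le hc₀ hK hvar ht

/-- **stub C3 (lead c8, wave 13): bond-gradient tails under the pinned thin Gaussian.**  With `H`, `H'` as in G6/C1:
for `K > 0`, every bond `(x,i)` and `t ≥ 0`, `P_{N(0,(K•H')⁻¹)}(|d₀ψ̂(x,i)| ≥ t) ≤ 2e^{−c₀Kt²}`. [folklore] -/
theorem stub_bondGradientTail :
    ∀ (r : ℕ) (c : Table r) (c₀ : ℝ), 2 ≤ r → 0 < c₀ → (∀ n ∈ c.support, ∑ w, n w = 0) →
      c.sum (fun _ a => a) = 0 →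
      (∀ φ : W r → ℝ, c₀ * ∑ w, ∑ w', (1 - Real.cos (φ w - φ w')) ≤ (genF c φ).re) →
      ∀ (L M : ℕ) [NeZero L] [NeZero M]
      (H : Matrix (Λ L M) (Λ L M) ℝ),
      (∀ i j : Λ L M, H i j = (-(∑ k : Λ L M × ↥c.support, c k.2 *
          ((∑ w, ((k.2 : Freq r) w : ℝ) * (if sh L M k.1 w = i then (1 : ℝ) else 0) : ℝ) : ℂ) *
          ((∑ w, ((k.2 : Freq r) w : ℝ) * (if sh L M k.1 w = j then (1 : ℝ) else 0) : ℝ) : ℂ))).re) →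
      ∀ (K : ℝ), 0 < K → ∀ (x : Λ L M) (i : Fin 3) (t : ℝ), 0 ≤ t →
        (ProbabilityTheory.multivariateGaussian 0
            (K • H.submatrix Subtype.val Subtype.val :
              Matrix (TorusChart.Punctured (Λ L M)) (TorusChart.Punctured (Λ L M)) ℝ)⁻¹)
          {ψ | t ≤ |(TorusChart.piProdZMod 2 L M).d₀ (TorusChart.extZero (WithLp.ofLp ψ)) x i|} ≤
        ENNReal.ofReal (2 * Real.exp (-(c₀ * K * t ^ 2))) := by
  intro r c c₀ hr hc₀ hU1 hN hC L M _ _ H hH K hK x i t ht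
  -- `K • H'` is positive definite (as in C1): `H` is the symmetric matrix of the coercive thin form
  have hHeq : (Matrix.of fun i j : Λ L M => (-(∑ k : Λ L M × ↥c.support, c k.2 *
      ((∑ w, ((k.2 : Freq r) w : ℝ) * (if sh L M k.1 w = i then (1 : ℝ) else 0) : ℝ) : ℂ) *
      ((∑ w, ((k.2 : Freq r) w : ℝ) * (if sh L M k.1 w = j then (1 : ℝ) else 0) : ℝ) : ℂ))).re) = H := by
    ext i j
    rw [Matrix.of_apply, hH i j]
  have hsymm : H.IsSymm := sectorNormalForm_isSymm c H hH
  have hcoer : ∀ φ : Λ L M → ℝ,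
      2 * c₀ * ∑ x : Λ L M, ∑ i : Fin 3, ((TorusChart.piProdZMod 2 L M).d₀ φ x i) ^ 2 ≤ φ ⬝ᵥ H *ᵥ φ := by
    intro φ
    refine (stub_thinFormCoercive r c c₀ hr hc₀ hN hC L M ((TorusChart.piProdZMod 2 L M).d₀ φ)).trans_eq ?_
    rw [thinForm_d0_eq_hessianForm r c hU1 L M φ, hHeq]
  have hpdK : (K • H.submatrix Subtype.val Subtype.val :
      Matrix (TorusChart.Punctured (Λ L M)) (TorusChart.Punctured (Λ L M)) ℝ).PosDef :=
    (TorusChart.posDef_submatrix_of_d₀_coercive (TorusChart.piProdZMod 2 L M) H hsymm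
      (by positivity : (0 : ℝ) < 2 * c₀) hcoer).smul hK
  -- the event is `{t ≤ |a·ψ|}` for the bond functional `a`, whose variance is bounded by C1
  simp only [TorusChart.d₀_apply, ← bondGradPrec_dotProduct_eq]
  exact hsc_bondTail_functional_le hpdK.inv.posSemidef _ hc₀ hK
    (stub_bondGradientPrecision r c c₀ hr hc₀ hU1 hN hC L M H hH K hK x i) ht

end Summit.HubbardSuperconductivity.HubbardSuperconductivity.Theorems.FSUnfolding

end
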